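import Mathlib
import HarnessLib

/-!
# Orbit averaging of a predictor over a finite group action: the invariance lemma
# (Chen–Dobriban–Lee, Lemma 1) and the least-squares picture (Elesedy–Zaidi, Prop. 3)

Topic `Computability/Learning`.  PUBLISHED STATEMENTS with complete elementary proofs in the FINITE
setting (finite group, finitely supported invariant weight); one definition (`orbitAvg`) and NO named
fact (`def … : Prop`) (D-0026).  The tree already has group averaging of VECTORS under a linear
representation (`Representation.averageMap` in Mathlib; `groupAverage`, `reynolds_*` lemmas in
Literature) but not the averaging of a FUNCTION over a group acting on its DOMAIN together with the
risk statements below (`lean search 'orbitAverage|symmetriz|invariant.*risk'`: nothing relevant).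

HONEST FRAMING: instance-level adjudication of specific advantage claims; no claim about BQP vs BPP
or the summit.  (Context: the geometric-QML records of the pub-qadeq cell repeatedly find that the
gain attributed to an "equivariant" model is a property of the symmetric PRIOR, available verbatim to
any model class; the statements below are the model-agnostic content of that remark.)

## Sources (read on the materialised texts) and what is taken

* S. Chen, E. Dobriban, J. H. Lee, *A group-theoretic framework for data augmentation*
  (arXiv:1907.10905; JMLR 21(245), 2020) [ChenDobribanLee2019] — held text `paper:arxiv-1907.10905`
  (arXiv v1, title *Invariance reduces variance …*), chunk p0011 = §4.1 **Lemma 1 (Invariance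
  lemma)**: under exact invariance (`gX =_d X`), with the orbit average `f̄(x) := E_{g∼Q} f(gx)`:
  (2) "the mean of `f̄(X)` and `f(X)` coincide: `E f(X) = E f̄(X)`"; (4) "Let `φ` be any real-valued
  convex function. Then `E[φ(f(X))] ≥ E[φ(f̄(X))]`"; proof p0027 §9.1 ("Part 4 follows from
  Jensen's inequality").  Prop. 2 ibid.: "for any convex loss function `L(θ₀, ·)`, we have
  `E L(θ₀, θ̂(X)) ≥ E L(θ₀, θ̂_G(X))`."
* B. Elesedy, S. Zaidi, *Provably strict generalisation benefit for equivariant models*, ICML 2021,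
  PMLR 139 (arXiv:2102.10333) [ElesedyZaidi2021] — held text `paper:arxiv-2102.10333`, chunk p0006
  §4.1 "Orbit Averaging … `(O f)(x) = ∫_G f(gx) dλ(g)`", "a function is `G`-invariant if and only if
  it is preserved by orbit averaging"; Lemma 1, properties (B) "`f` is `G`-equivariant iff `Q f = f`"
  and (D) "`Q` is self-adjoint with respect to `⟨·,·⟩_μ` … depends on the `G`-invariance of `μ`";
  chunk p0008 §5 **Proposition 3 (Feature averaging as a least-squares problem)**: "feature averaging
  sends `f` to `f̄`, where `f̄` is the closest `G`-invariant feature extractor to `f`"; chunk p0018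
  Prop. 23 (`‖Q f‖_μ ≤ ‖f‖_μ` by Jensen + invariance of `μ`), Prop. 24 (`f` equivariant iff `Q f = f`).

## What is formalised (finite `G`, arbitrary `G`-set `X`, values in a real vector space `E`)

* `orbitAvg G f x = (card G)⁻¹ • ∑ g, f (g • x)` — the operator `O` ∕ the orbit average `f̄` with `Q`
  the uniform (= Haar) law on the finite group;
* `orbitAvg_smul` (`O f` is invariant), `orbitAvg_of_invariant` ∕ `invariant_iff_orbitAvg_eq`
  (EZ Lemma 1 (B), Prop. 24 for the trivial representation), `orbitAvg_idem`, linearity;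
* with a finitely supported `G`-INVARIANT weight `μ : X → ℝ` (`μ (g • x) = μ x`; the finite form of
  "exact invariance"): `sum_smul_orbitAvg_eq` — **CDL Lemma 1 (2)** `∑ μ x • O f x = ∑ μ x • f x`;
  `convexOn_apply_orbitAvg_le` (pointwise Jensen) and **`sum_mul_convex_orbitAvg_le` — CDL Lemma 1 (4)**
  `∑ μ x φ(O f x) ≤ ∑ μ x φ(f x)` for convex `φ : E → ℝ` and `μ ≥ 0`; `risk_orbitAvg_le` — the same
  with an `x`-dependent `G`-invariant convex loss `ℓ x` (invariant labels), i.e. CDL Prop. 2's "no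
  worse according to any convex loss" for predictors; `sum_mul_orbitAvg_sq_le` — EZ Prop. 23;
* `orbitAvg_selfAdjoint` — **EZ Lemma 1 (D)** `∑ μ (O f) h = ∑ μ f (O h)`; `sum_mul_sq_sub_eq` —
  the Pythagoras identity `‖f - s‖²_μ = ‖f - O f‖²_μ + ‖O f - s‖²_μ` for invariant `s`, and
  **`sum_mul_sq_sub_orbitAvg_le` — EZ Prop. 3** (`O f` is a closest invariant function in `L²(μ)`).

* `sum_mul_sq_sub_const_eq` ∕ `sum_mul_sq_sub_orbitAvg_eq_condVar` — **CDL Lemma 1 (3)** in the scalar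
  finite form (law of total variance): `∑ μ (f - m)² = ∑ μ (O f - m)² + ∑ μ (f - O f)²` for every constant
  `m`, the last term being `∑_x μ x · |G|⁻¹ ∑_g (f(g • x) - (O f)(x))²` ("`E Cov_g f(gX)`").

* `equivAvg ρ f x = |G|⁻¹ • ∑ g, ρ g⁻¹ (f (g • x))` — Elesedy–Zaidi's EQUIVARIANT averaging operator `Q`
  for a representation `ρ : Representation ℝ G E` (`ψ` in the paper): `equivAvg_smul` (`Q f` is
  equivariant: `Q f (h • x) = ρ h (Q f x)`), **`equivariant_iff_equivAvg_eq` — EZ Prop. 24 ∕ Lemma 1 (B)**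
  (`f` equivariant iff `Q f = f`), `equivAvg_idem` (Lemma 1 (C)), `equivAvg_trivial` (`O` is `Q` for the
  trivial representation, as the paper notes).

Not taken: the measure-theoretic generality (compact `G`, Haar measure, Bochner spaces), the
matrix-valued covariance form of CDL Lemma 1 (3), the self-adjointness ∕ least-squares statements for
`Q` with a `ρ`-invariant inner product (only the `O` case is done), and everything on generalisation
gaps.  `-- TODO(general form): compact groups / probability measures via Mathlib's
MeasureTheory; only the finite case is needed by the cell.`
-/

open Finset BigOperators

namespace Literature.Computability.Learning.OrbitAveraging

variable {G : Type*} {X : Type*} {E : Type*} [Group G] [Fintype G] [MulAction G X]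
variable [AddCommGroup E] [Module ℝ E]

variable (G) in
/-- The ORBIT AVERAGE of `f : X → E` over a finite group `G` acting on `X`:
`(O f)(x) = |G|⁻¹ ∑_{g ∈ G} f (g • x)` — Chen–Dobriban–Lee's `f̄(x) = E_{g∼Q} f(gx)` with `Q` uniform,
Elesedy–Zaidi's operator `O`. [cite: ChenDobribanLee2019, §4.1 Lemma 1]
[cite: ElesedyZaidi2021, §4.1 (Orbit Averaging)] -/
noncomputable def orbitAvg (f : X → E) : X → E :=
  fun x => ((Fintype.card G : ℝ)⁻¹) • ∑ g : G, f (g • x)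

/-- Unfolding lemma. [cite: ElesedyZaidi2021, §4.1] -/
theorem orbitAvg_apply (f : X → E) (x : X) :
    orbitAvg G f x = ((Fintype.card G : ℝ)⁻¹) • ∑ g : G, f (g • x) := rfl

/-- A finite group is nonempty, so `0 < |G|` in `ℝ` (plumbing). [folklore] -/
private theorem card_pos : (0 : ℝ) < (Fintype.card G : ℝ) := by
  exact_mod_cast (Fintype.card_pos : 0 < Fintype.card G)

/-- `|G| ≠ 0` in `ℝ` (plumbing). [folklore] -/
private theorem card_ne_zero : (Fintype.card G : ℝ) ≠ 0 := ne_of_gt card_pos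

/-- `|G|⁻¹ • (|G| • e) = e` (plumbing for the averages of constant families). [folklore] -/
private theorem inv_card_smul_card_smul (e : E) :
    ((Fintype.card G : ℝ)⁻¹) • (Fintype.card G • e) = e := by
  rw [← Nat.cast_smul_eq_nsmul ℝ, smul_smul, inv_mul_cancel₀ card_ne_zero, one_smul]

/-- `O f` is `G`-invariant: `(O f)(h • x) = (O f)(x)` (reindex `g ↦ g h`).
[cite: ElesedyZaidi2021, §4.1 ("we can construct a G-invariant feature map by averaging")]
[cite: ChenDobribanLee2019, §4.1 Lemma 1] -/
theorem orbitAvg_smul (f : X → E) (h : G) (x : X) :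
    orbitAvg G f (h • x) = orbitAvg G f x := by
  simp only [orbitAvg_apply, smul_smul]
  congr 1
  exact Fintype.sum_equiv (Equiv.mulRight h) _ _ (fun g => rfl)

/-- A `G`-invariant function is fixed by `O`. [cite: ElesedyZaidi2021, Lemma 1 (B), Prop. 24] -/
theorem orbitAvg_of_invariant {f : X → E} (hf : ∀ (g : G) (x : X), f (g • x) = f x) :
    orbitAvg G f = f := by
  funext x
  simp only [orbitAvg_apply, hf, Finset.sum_const, Finset.card_univ]
  exact inv_card_smul_card_smul (G := G) (f x)

/-- **Invariant iff preserved by orbit averaging.** [cite: ElesedyZaidi2021, §4 ("a function is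
G-invariant if and only if it is preserved by orbit averaging"), Lemma 1 (B), Prop. 24] -/
theorem invariant_iff_orbitAvg_eq (f : X → E) :
    (∀ (g : G) (x : X), f (g • x) = f x) ↔ orbitAvg G f = f := by
  refine ⟨orbitAvg_of_invariant, fun h g x => ?_⟩
  have := orbitAvg_smul (G := G) f g x
  rwa [h] at this

/-- `O` is idempotent (`O` has eigenvalues `0`, `1` only). [cite: ElesedyZaidi2021, Lemma 1 (C)] -/
theorem orbitAvg_idem (f : X → E) : orbitAvg G (orbitAvg G f) = orbitAvg G f :=
  orbitAvg_of_invariant (orbitAvg_smul f)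

/-- Constants are fixed. [cite: ElesedyZaidi2021, Lemma 1 (B)] -/
theorem orbitAvg_const (e : E) : orbitAvg G (fun _ : X => e) = fun _ => e :=
  orbitAvg_of_invariant (fun _ _ => rfl)

/-- `O` is additive. [cite: ElesedyZaidi2021, §4.1 (O is a linear operator on V)] -/
theorem orbitAvg_add (f₁ f₂ : X → E) :
    orbitAvg G (f₁ + f₂) = orbitAvg G f₁ + orbitAvg G f₂ := by
  funext x
  simp only [orbitAvg_apply, Pi.add_apply, Finset.sum_add_distrib, smul_add]

/-- `O` commutes with scalars. [cite: ElesedyZaidi2021, §4.1 (O is a linear operator on V)] -/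
theorem orbitAvg_const_smul (c : ℝ) (f : X → E) :
    orbitAvg G (c • f) = c • orbitAvg G f := by
  funext x
  simp only [orbitAvg_apply, Pi.smul_apply, ← Finset.smul_sum, smul_comm c]

/-- `O` commutes with subtraction. [cite: ElesedyZaidi2021, §4.1] -/
theorem orbitAvg_sub (f₁ f₂ : X → E) :
    orbitAvg G (f₁ - f₂) = orbitAvg G f₁ - orbitAvg G f₂ := by
  funext x
  simp only [orbitAvg_apply, Pi.sub_apply, Finset.sum_sub_distrib, smul_sub]

/-! ## Invariant weights: mean preservation (CDL Lemma 1 (2)) -/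

section Weight

variable [Fintype X]

omit [Fintype G] in
/-- Reindexing by the action: for a `G`-invariant weight `μ`,
`∑_x μ x • f (g • x) = ∑_x μ x • f x` (`x ↦ g • x` is a permutation of `X`).
[cite: ChenDobribanLee2019, §9.1 (proof of Lemma 1: "translation invariant property")] -/
theorem sum_smul_comp_smul_eq {μ : X → ℝ} (hμ : ∀ (g : G) (x : X), μ (g • x) = μ x)
    (f : X → E) (g : G) :
    ∑ x, μ x • f (g • x) = ∑ x, μ x • f x := by
  refine Fintype.sum_equiv (MulAction.toPerm g) _ _ (fun x => ?_)
  simp only [MulAction.toPerm_apply, hμ]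

/-- **Chen–Dobriban–Lee Lemma 1 (2)** (finite form): orbit averaging preserves the mean under a
`G`-invariant weight, `∑_x μ x • (O f) x = ∑_x μ x • f x` ("the mean of `f̄(X)` and `f(X)` coincide").
[cite: ChenDobribanLee2019, §4.1 Lemma 1 (2)] -/
theorem sum_smul_orbitAvg_eq {μ : X → ℝ} (hμ : ∀ (g : G) (x : X), μ (g • x) = μ x) (f : X → E) :
    ∑ x, μ x • orbitAvg G f x = ∑ x, μ x • f x := by
  have h1 : ∀ x, μ x • orbitAvg G f x
      = ((Fintype.card G : ℝ)⁻¹) • ∑ g : G, μ x • f (g • x) := fun x => by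
    rw [orbitAvg_apply, smul_comm, Finset.smul_sum]
  simp_rw [h1]
  rw [← Finset.smul_sum, Finset.sum_comm]
  simp_rw [sum_smul_comp_smul_eq hμ f]
  rw [Finset.sum_const, Finset.card_univ]
  exact inv_card_smul_card_smul (G := G) _

/-- Scalar-valued form of CDL Lemma 1 (2): `∑_x μ x * (O f) x = ∑_x μ x * f x`.
[cite: ChenDobribanLee2019, §4.1 Lemma 1 (2)] -/
theorem sum_mul_orbitAvg_eq {μ : X → ℝ} (hμ : ∀ (g : G) (x : X), μ (g • x) = μ x) (f : X → ℝ) :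
    ∑ x, μ x * orbitAvg G f x = ∑ x, μ x * f x := by
  simpa only [smul_eq_mul] using sum_smul_orbitAvg_eq (G := G) hμ f

/-! ## Jensen: convex functions of the orbit average (CDL Lemma 1 (4), Prop. 2; EZ Prop. 23) -/

omit [Fintype X] in
/-- Pointwise Jensen step: for convex `φ`, `φ((O f) x) ≤ (O (φ ∘ f)) x`.
[cite: ChenDobribanLee2019, §9.1 ("Part 4 follows from Jensen's inequality")] -/
theorem convexOn_apply_orbitAvg_le {φ : E → ℝ} (hφ : ConvexOn ℝ Set.univ φ) (f : X → E) (x : X) :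
    φ (orbitAvg G f x) ≤ orbitAvg G (φ ∘ f) x := by
  have hw : ∑ _g : G, ((Fintype.card G : ℝ)⁻¹) = 1 := by
    rw [Finset.sum_const, Finset.card_univ, nsmul_eq_mul, mul_inv_cancel₀ card_ne_zero]
  have := hφ.map_sum_le (t := Finset.univ) (w := fun _ : G => (Fintype.card G : ℝ)⁻¹)
    (p := fun g => f (g • x)) (fun _ _ => le_of_lt (inv_pos.mpr card_pos)) hw
    (fun _ _ => Set.mem_univ _)
  simpa only [orbitAvg_apply, Function.comp, Finset.smul_sum, smul_eq_mul, Finset.mul_sum] using this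

/-- **Chen–Dobriban–Lee Lemma 1 (4)** (finite form): for a nonnegative `G`-invariant weight `μ` and
a convex `φ`, `∑_x μ x φ((O f) x) ≤ ∑_x μ x φ(f x)` ("`E[φ(f(X))] ≥ E[φ(f̄(X))]`").
[cite: ChenDobribanLee2019, §4.1 Lemma 1 (4)] -/
theorem sum_mul_convex_orbitAvg_le {μ : X → ℝ} (hμ0 : ∀ x, 0 ≤ μ x)
    (hμ : ∀ (g : G) (x : X), μ (g • x) = μ x) {φ : E → ℝ} (hφ : ConvexOn ℝ Set.univ φ)
    (f : X → E) :
    ∑ x, μ x * φ (orbitAvg G f x) ≤ ∑ x, μ x * φ (f x) := by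
  calc ∑ x, μ x * φ (orbitAvg G f x) ≤ ∑ x, μ x * orbitAvg G (φ ∘ f) x :=
        Finset.sum_le_sum (fun x _ =>
          mul_le_mul_of_nonneg_left (convexOn_apply_orbitAvg_le hφ f x) (hμ0 x))
    _ = ∑ x, μ x * (φ ∘ f) x := sum_mul_orbitAvg_eq hμ (φ ∘ f)
    _ = ∑ x, μ x * φ (f x) := rfl

omit [Fintype X] in
/-- Pointwise Jensen step with an `x`-dependent `G`-INVARIANT convex loss `ℓ x : E → ℝ` (e.g.
`ℓ x v = L(v, y x)` with `G`-invariant labels `y`): `ℓ x ((O f) x) ≤ (O (x ↦ ℓ x (f x))) x`.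
[cite: ChenDobribanLee2019, §4.1 Lemma 1 (4) and Prop. 2] -/
theorem loss_orbitAvg_le {ℓ : X → E → ℝ} (hℓG : ∀ (g : G) (x : X), ℓ (g • x) = ℓ x)
    (hℓ : ∀ x, ConvexOn ℝ Set.univ (ℓ x)) (f : X → E) (x : X) :
    ℓ x (orbitAvg G f x) ≤ orbitAvg G (fun y => ℓ y (f y)) x := by
  have h1 : ℓ x (orbitAvg G f x) ≤ orbitAvg G (ℓ x ∘ f) x := convexOn_apply_orbitAvg_le (hℓ x) f x
  have h2 : orbitAvg G (ℓ x ∘ f) x = orbitAvg G (fun y => ℓ y (f y)) x := by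
    simp only [orbitAvg_apply, Function.comp, hℓG]
  exact h2 ▸ h1

/-- **Risk of the orbit-averaged predictor** (CDL Prop. 2 for predictors, finite form): with a
nonnegative `G`-invariant weight `μ` and a `G`-invariant loss convex in the prediction,
`∑_x μ x ℓ x ((O f) x) ≤ ∑_x μ x ℓ x (f x)` — symmetrising ANY predictor (from any model class) never
increases its risk on an invariant task. [cite: ChenDobribanLee2019, §4.1 Lemma 1 (4), Prop. 2
("the augmented estimator is no worse than the original estimator according to any convex loss")] -/
theorem risk_orbitAvg_le {μ : X → ℝ} (hμ0 : ∀ x, 0 ≤ μ x)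
    (hμ : ∀ (g : G) (x : X), μ (g • x) = μ x) {ℓ : X → E → ℝ}
    (hℓG : ∀ (g : G) (x : X), ℓ (g • x) = ℓ x) (hℓ : ∀ x, ConvexOn ℝ Set.univ (ℓ x)) (f : X → E) :
    ∑ x, μ x * ℓ x (orbitAvg G f x) ≤ ∑ x, μ x * ℓ x (f x) := by
  calc ∑ x, μ x * ℓ x (orbitAvg G f x) ≤ ∑ x, μ x * orbitAvg G (fun y => ℓ y (f y)) x :=
        Finset.sum_le_sum (fun x _ =>
          mul_le_mul_of_nonneg_left (loss_orbitAvg_le hℓG hℓ f x) (hμ0 x))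
    _ = ∑ x, μ x * ℓ x (f x) := sum_mul_orbitAvg_eq hμ _

/-- **Elesedy–Zaidi Prop. 23** (finite, scalar form): `‖O f‖²_μ ≤ ‖f‖²_μ`, i.e.
`∑_x μ x ((O f) x)² ≤ ∑_x μ x (f x)²` ("Jensen's inequality … and finally the invariance of `μ`").
[cite: ElesedyZaidi2021, App. B Prop. 23] -/
theorem sum_mul_orbitAvg_sq_le {μ : X → ℝ} (hμ0 : ∀ x, 0 ≤ μ x)
    (hμ : ∀ (g : G) (x : X), μ (g • x) = μ x) (f : X → ℝ) :
    ∑ x, μ x * (orbitAvg G f x) ^ 2 ≤ ∑ x, μ x * (f x) ^ 2 :=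
  sum_mul_convex_orbitAvg_le hμ0 hμ (Even.convexOn_pow (n := 2) even_two) f

/-! ## Self-adjointness and the least-squares picture (EZ Lemma 1 (D), Prop. 3) -/

omit [Fintype G] in
/-- Reindexing step for self-adjointness: `∑_x μ x f(g • x) h x = ∑_x μ x f x h(g⁻¹ • x)`.
[cite: ElesedyZaidi2021, Lemma 1 (D) (proof: invariance of μ)] -/
theorem sum_mul_comp_smul_mul_eq {μ : X → ℝ} (hμ : ∀ (g : G) (x : X), μ (g • x) = μ x)
    (f h : X → ℝ) (g : G) :
    ∑ x, μ x * f (g • x) * h x = ∑ x, μ x * f x * h (g⁻¹ • x) := by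
  refine Fintype.sum_equiv (MulAction.toPerm g) _ _ (fun x => ?_)
  simp only [MulAction.toPerm_apply, hμ, inv_smul_smul]

omit [Fintype X] in
/-- `∑_g h (g⁻¹ • x) = ∑_g h (g • x)` (reindex by inversion). [cite: ElesedyZaidi2021, Lemma 1 (D)] -/
theorem sum_comp_inv_smul (h : X → ℝ) (x : X) :
    ∑ g : G, h (g⁻¹ • x) = ∑ g : G, h (g • x) :=
  Fintype.sum_equiv (Equiv.inv G) _ _ (fun g => by simp only [Equiv.inv_apply])

/-- **Elesedy–Zaidi Lemma 1 (D)** (finite, scalar form): `O` is self-adjoint for `⟨f, h⟩_μ =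
∑_x μ x f x h x` when `μ` is `G`-invariant: `⟨O f, h⟩_μ = ⟨f, O h⟩_μ`.
[cite: ElesedyZaidi2021, Lemma 1 (D) ("critical and depends on the G-invariance of μ")] -/
theorem orbitAvg_selfAdjoint {μ : X → ℝ} (hμ : ∀ (g : G) (x : X), μ (g • x) = μ x)
    (f h : X → ℝ) :
    ∑ x, μ x * orbitAvg G f x * h x = ∑ x, μ x * f x * orbitAvg G h x := by
  have hL : ∀ x, μ x * orbitAvg G f x * h x
      = ((Fintype.card G : ℝ)⁻¹) * ∑ g : G, μ x * f (g • x) * h x := fun x => by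
    rw [orbitAvg_apply, smul_eq_mul, Finset.mul_sum, Finset.mul_sum, Finset.sum_mul,
      Finset.mul_sum]
    exact Finset.sum_congr rfl (fun g _ => by ring)
  have hR : ∀ x, μ x * f x * orbitAvg G h x
      = ((Fintype.card G : ℝ)⁻¹) * ∑ g : G, μ x * f x * h (g • x) := fun x => by
    rw [orbitAvg_apply, smul_eq_mul, Finset.mul_sum, Finset.mul_sum, Finset.mul_sum]
    exact Finset.sum_congr rfl (fun g _ => by ring)
  simp_rw [hL, hR]
  rw [← Finset.mul_sum, ← Finset.mul_sum, Finset.sum_comm,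
    Finset.sum_comm (s := (Finset.univ : Finset X))]
  congr 1
  simp_rw [sum_mul_comp_smul_mul_eq hμ f h]
  -- `∑_g ∑_x μ x f x h (g⁻¹ • x) = ∑_g ∑_x μ x f x h (g • x)`: reindex the outer sum by inversion
  exact Fintype.sum_equiv (Equiv.inv G) _ _ (fun g => by simp only [Equiv.inv_apply])

/-- **Pythagoras for orbit averaging**: for a `G`-invariant weight `μ` and a `G`-invariant `s`,
`‖f - s‖²_μ = ‖f - O f‖²_μ + ‖O f - s‖²_μ` (the anti-symmetric part `f - O f` is `μ`-orthogonal to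
every invariant function). [cite: ElesedyZaidi2021, Lemma 1 (U = S ⊕ A orthogonally), Prop. 3] -/
theorem sum_mul_sq_sub_eq {μ : X → ℝ} (hμ : ∀ (g : G) (x : X), μ (g • x) = μ x)
    (f s : X → ℝ) (hs : ∀ (g : G) (x : X), s (g • x) = s x) :
    ∑ x, μ x * (f x - s x) ^ 2
      = ∑ x, μ x * (f x - orbitAvg G f x) ^ 2 + ∑ x, μ x * (orbitAvg G f x - s x) ^ 2 := by
  -- the invariant function `d = O f - s` is fixed by `O`
  set d : X → ℝ := fun x => orbitAvg G f x - s x with hd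
  have hdG : ∀ (g : G) (x : X), d (g • x) = d x := fun g x => by
    simp only [hd, orbitAvg_smul, hs]
  have hOd : orbitAvg G d = d := orbitAvg_of_invariant hdG
  -- cross term vanishes: `⟨O f, d⟩ = ⟨f, O d⟩ = ⟨f, d⟩`
  have hcross : ∑ x, μ x * orbitAvg G f x * d x = ∑ x, μ x * f x * d x := by
    rw [orbitAvg_selfAdjoint hμ f d, hOd]
  have hpt : ∀ x, μ x * (f x - s x) ^ 2
      = μ x * (f x - orbitAvg G f x) ^ 2 + μ x * (orbitAvg G f x - s x) ^ 2
        + 2 * (μ x * f x * d x - μ x * orbitAvg G f x * d x) := fun x => by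
    simp only [hd]; ring
  simp_rw [hpt]
  rw [Finset.sum_add_distrib, Finset.sum_add_distrib, ← Finset.mul_sum, Finset.sum_sub_distrib,
    hcross, sub_self, mul_zero, add_zero]

/-- **Elesedy–Zaidi Prop. 3 (feature averaging as a least-squares problem)** (finite form): for a
nonnegative `G`-invariant weight `μ`, `O f` is a closest `G`-invariant function to `f` in `L²(μ)`:
`‖f - O f‖²_μ ≤ ‖f - s‖²_μ` for every invariant `s`. [cite: ElesedyZaidi2021, §5 Prop. 3] -/
theorem sum_mul_sq_sub_orbitAvg_le {μ : X → ℝ} (hμ0 : ∀ x, 0 ≤ μ x)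
    (hμ : ∀ (g : G) (x : X), μ (g • x) = μ x) (f s : X → ℝ)
    (hs : ∀ (g : G) (x : X), s (g • x) = s x) :
    ∑ x, μ x * (f x - orbitAvg G f x) ^ 2 ≤ ∑ x, μ x * (f x - s x) ^ 2 := by
  rw [sum_mul_sq_sub_eq hμ f s hs]
  exact le_add_of_nonneg_right (Finset.sum_nonneg (fun x _ => mul_nonneg (hμ0 x) (sq_nonneg _)))

/-- **Chen–Dobriban–Lee Lemma 1 (3)** (scalar finite form, law of total variance about any constant
`m`): for a `G`-invariant weight `μ`, `∑_x μ x (f x - m)² = ∑_x μ x ((O f) x - m)² + ∑_x μ x (f x - (O f) x)²`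
("the covariance of `f(X)` can be decomposed as `Cov f̄(X) + E Cov_g f(gX)`"; with `m` the common mean of
`f` and `O f` these are the variances). [cite: ChenDobribanLee2019, §4.1 Lemma 1 (3)] -/
theorem sum_mul_sq_sub_const_eq {μ : X → ℝ} (hμ : ∀ (g : G) (x : X), μ (g • x) = μ x)
    (f : X → ℝ) (m : ℝ) :
    ∑ x, μ x * (f x - m) ^ 2
      = ∑ x, μ x * (orbitAvg G f x - m) ^ 2 + ∑ x, μ x * (f x - orbitAvg G f x) ^ 2 := by
  rw [sum_mul_sq_sub_eq hμ f (fun _ => m) (fun _ _ => rfl), add_comm]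

omit [Fintype X] in
/-- The within-orbit term pointwise: `(O ((f - O f)²))(x) = |G|⁻¹ ∑_g (f (g • x) - (O f)(x))²`, i.e. the
variance of `f(gx)` over `g` uniform in `G` ("`Cov_{g∼Q} f(gX)`"). [cite: ChenDobribanLee2019, §4.1
Lemma 1 (3)] -/
theorem orbitAvg_sq_sub_orbitAvg_apply (f : X → ℝ) (x : X) :
    orbitAvg G (fun y => (f y - orbitAvg G f y) ^ 2) x
      = ((Fintype.card G : ℝ)⁻¹) * ∑ g : G, (f (g • x) - orbitAvg G f x) ^ 2 := by
  simp only [orbitAvg_apply (G := G) (fun y => (f y - orbitAvg G f y) ^ 2), orbitAvg_smul,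
    smul_eq_mul]

/-- **CDL Lemma 1 (3), the `E Cov_g f(gX)` form of the within-orbit term**: for a `G`-invariant weight,
`∑_x μ x (f x - (O f) x)² = ∑_x μ x · |G|⁻¹ ∑_g (f (g • x) - (O f)(x))²`.
[cite: ChenDobribanLee2019, §4.1 Lemma 1 (3)] -/
theorem sum_mul_sq_sub_orbitAvg_eq_condVar {μ : X → ℝ} (hμ : ∀ (g : G) (x : X), μ (g • x) = μ x)
    (f : X → ℝ) :
    ∑ x, μ x * (f x - orbitAvg G f x) ^ 2
      = ∑ x, μ x * (((Fintype.card G : ℝ)⁻¹) * ∑ g : G, (f (g • x) - orbitAvg G f x) ^ 2) := by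
  have h := (sum_mul_orbitAvg_eq (G := G) hμ (fun y => (f y - orbitAvg G f y) ^ 2)).symm
  simp only [orbitAvg_sq_sub_orbitAvg_apply] at h
  exact h

end Weight

/-! ## Equivariant averaging: Elesedy–Zaidi's operator `Q` (§4.1, App. B Props. 23–24) -/

section Equivariant

/-- Elesedy–Zaidi's EQUIVARIANT averaging operator for a representation `ρ` of `G` on the value space
(`ψ` in the paper): `(Q f)(x) = |G|⁻¹ ∑_g ρ(g⁻¹) f(g • x)` — "we can transform `f` into an equivariant
feature map by applying `Q`, where `(Q f)(x) = ∫_G ψ(g⁻¹) f(gx) dλ(g)`".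
[cite: ElesedyZaidi2021, §4.1 (Orbit Averaging, operator Q); App. B] -/
noncomputable def equivAvg (ρ : Representation ℝ G E) (f : X → E) : X → E :=
  fun x => ((Fintype.card G : ℝ)⁻¹) • ∑ g : G, ρ g⁻¹ (f (g • x))

/-- Unfolding lemma. [cite: ElesedyZaidi2021, §4.1] -/
theorem equivAvg_apply (ρ : Representation ℝ G E) (f : X → E) (x : X) :
    equivAvg ρ f x = ((Fintype.card G : ℝ)⁻¹) • ∑ g : G, ρ g⁻¹ (f (g • x)) := rfl

omit [Fintype G] in
/-- `ρ(g⁻¹) ρ(g) = 1` applied (plumbing). [folklore] -/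
private theorem rho_inv_cancel_left (ρ : Representation ℝ G E) (g : G) (v : E) :
    ρ g⁻¹ (ρ g v) = v := by
  rw [← Module.End.mul_apply, ← map_mul, inv_mul_cancel, map_one, Module.End.one_apply]

omit [Fintype G] in
/-- `ρ(h) ρ((gh)⁻¹) = ρ(g⁻¹)` applied (plumbing for the reindexing `g ↦ gh`). [folklore] -/
private theorem rho_mul_inv_apply (ρ : Representation ℝ G E) (g h : G) (v : E) :
    ρ h (ρ (g * h)⁻¹ v) = ρ g⁻¹ v := by
  rw [mul_inv_rev, map_mul, Module.End.mul_apply, ← Module.End.mul_apply (ρ h), ← map_mul,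
    mul_inv_cancel, map_one, Module.End.one_apply]

/-- `Q f` is `G`-EQUIVARIANT: `(Q f)(h • x) = ρ(h) (Q f)(x)` (reindex `g ↦ g h`).
[cite: ElesedyZaidi2021, §4.1 ("transform f into an equivariant feature map by applying Q"),
App. B Prop. 23] -/
theorem equivAvg_smul (ρ : Representation ℝ G E) (f : X → E) (h : G) (x : X) :
    equivAvg ρ f (h • x) = ρ h (equivAvg ρ f x) := by
  simp only [equivAvg_apply, map_smul, map_sum, smul_smul]
  congr 1
  exact Fintype.sum_equiv (Equiv.mulRight h) _ _
    (fun g => by simp only [Equiv.coe_mulRight]; exact (rho_mul_inv_apply ρ g h _).symm)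

/-- An equivariant `f` (`f (g • x) = ρ g (f x)`) is fixed by `Q`. [cite: ElesedyZaidi2021, App. B
Prop. 24 ("Suppose f is equivariant … then Q f = f"), Lemma 1 (B)] -/
theorem equivAvg_of_equivariant (ρ : Representation ℝ G E) {f : X → E}
    (hf : ∀ (g : G) (x : X), f (g • x) = ρ g (f x)) : equivAvg ρ f = f := by
  funext x
  simp only [equivAvg_apply, hf, rho_inv_cancel_left, Finset.sum_const, Finset.card_univ]
  exact inv_card_smul_card_smul (G := G) (f x)

/-- **Elesedy–Zaidi Prop. 24 ∕ Lemma 1 (B)**: `f` is equivariant iff `Q f = f`.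
[cite: ElesedyZaidi2021, App. B Prop. 24, Lemma 1 (B)] -/
theorem equivariant_iff_equivAvg_eq (ρ : Representation ℝ G E) (f : X → E) :
    (∀ (g : G) (x : X), f (g • x) = ρ g (f x)) ↔ equivAvg ρ f = f := by
  refine ⟨equivAvg_of_equivariant ρ, fun h g x => ?_⟩
  have := equivAvg_smul ρ f g x
  rwa [h] at this

/-- `Q` is idempotent (eigenvalues `0` and `1` only). [cite: ElesedyZaidi2021, Lemma 1 (C)] -/
theorem equivAvg_idem (ρ : Representation ℝ G E) (f : X → E) :
    equivAvg ρ (equivAvg ρ f) = equivAvg ρ f :=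
  equivAvg_of_equivariant ρ (equivAvg_smul ρ f)

/-- "`O` is a special case of `Q` corresponding to `ψ` being the trivial representation."
[cite: ElesedyZaidi2021, §4.1] -/
theorem equivAvg_trivial (f : X → E) :
    equivAvg (Representation.trivial ℝ G E) f = orbitAvg G f := by
  funext x
  simp [equivAvg_apply, orbitAvg_apply]

end Equivariant

/-! ## A two-element kernel check (the `C₂ = {±1}` action on `ℤ` by sign) -/

/-- Non-vacuity: for the sign action of `ℤˣ` on `ℤ`, the orbit average of the identity embedding
is `0` at every point (`(x + (-x))/2 = 0`). [folklore] -/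
private theorem orbitAvg_units_int_id (x : ℤ) :
    orbitAvg ℤˣ (fun z : ℤ => (z : ℝ)) x = 0 := by
  rw [orbitAvg_apply]
  have hsum : ∑ g : ℤˣ, (((g • x : ℤ)) : ℝ) = 0 := by
    rw [show (Finset.univ : Finset ℤˣ) = {1, -1} from by decide]
    simp [Units.smul_def]
  rw [hsum, smul_zero]

end Literature.Computability.Learning.OrbitAveraging
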